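import Literature.NumberTheory.EllipticCurves.Curve6137PhiSideK3
import Literature.NumberTheory.EllipticCurves.K3CubicCharacterNorm
import Literature.NumberTheory.EllipticCurves.ShaRestrictionIndex
import Literature.NumberTheory.EllipticCurves.GeomPointsGaloisModule
import Literature.NumberTheory.EllipticCurves.Curve6137ThreeDescentBox
import HarnessLib

/-!
# The carrier `y² − 21xy + 6137y = x³`: `Ш(E/ℚ) ∩ ker φ_* = 0` for its rational `3`-isogeny `φ`
# (Cohen–Pazuki 2009, Prop. 1.4 / Thm. 2.1, the `ℤ/3`-kernel side via `ℚ(ζ₃)` and the norm condition)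

Topic `NumberTheory/EllipticCurves`. The `φ`-side of the `3`-isogeny descent of the cross-prime
carrier `E = threeTorsionModel (−21/2) (6137/2)` of route ShaPrimaryTransfer (`φ` = Vélu's isogeny
of `ThreeIsogeny` with RATIONAL kernel `⟨(0, 6137/2)⟩`). Assembled from:

* `ThreeKernelCocycles` — a class `c ∈ ker φ_*` is `[σ ↦ n(σ)·T]` for a cubic character
  `n : Γ_ℚ → ℤ/3`;
* `K3CubicCharacterNorm` — `n|Γ_{K3}` is the Kummer character of `u ∈ K3*` with `N(u) ∈ ℚ*³`;
* `resBaseChange_oneCocycleClass` (here) — restriction `H¹(ℚ, E) → H¹(K3, E_{K3})` on explicit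
  cocycles, so `res c = [C_u]` for the `μ₃`-kernel datum of `E_{K3} = cpCurve a₃ b₃`
  (`Curve6137PhiSideK3.cpCurve_eq_threeTorsionModel`);
* `Curve6137PhiSideK3` — `[C_u] ∈ Ш(E/K3)` with cube norm vanishes;
* `ShaRestrictionIndex` — restriction is injective on `Ш[3]` as `3 ∤ [K3 : ℚ] = 2`.

Main statement: **`Carrier6137.eq_zero_of_mem_sha_of_galH1Map_geomHom_eq_zero`** —
`Ш(E/ℚ) ∩ ker φ_* = 0`, the tree's form of `Ш(E/ℚ)[φ] = 0`: the `φ`-Selmer group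
`Sel^φ(E/ℚ) ⊂ H¹(ℚ, ℤ/3)`, read in `G₃ ⊂ K3*/K3*³`, is `⟨[ζ₃]⟩ = α̂(Ê(ℚ))` (Cohen–Pazuki Prop. 2.2,
`a = 1`).

## References

* [CohenPazuki2009] H. Cohen, F. Pazuki, Acta Arith. 140 (2009), Prop. 1.4, Thm. 2.1, Prop. 2.2.
* [SilvermanAEC2009] J. H. Silverman, *AEC*, Thm. X.4.2, App. B (restriction).
-/

noncomputable section

open scoped Classical

open WeierstrassCurve IsDedekindDomain NumberField

namespace Literature.NumberTheory.EllipticCurves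

/-! ## Restriction on explicit cocycles -/

section Res

open GaloisRepresentations

variable {K : Type} [Field K] (W : WeierstrassCurve K) (L : Type) [Field L] [Algebra K L]

/-- **Restriction `H¹(K, E) → H¹(L, E_L)` on the class of a continuous crossed homomorphism**:
`res [g] = [τ ↦ Φ(pointsMap (g (τ|_K̄)))]`, `Φ` the identification `E(L̄) = E_L(L̄)`
(`localPointsEquivGeomPoints`). [cite: SilvermanAEC2009, App. B §2 (restriction)] -/
theorem resBaseChange_oneCocycleClass
    (g : contOneCocycles (discreteTopRep (Field.absoluteGaloisGroup K) (geomPoints W))) :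
    ∃ g' : contOneCocycles (discreteTopRep (Field.absoluteGaloisGroup L) (geomPoints (W.baseChange L))),
      (∀ τ, g'.1 τ = localPointsEquivGeomPoints W L (pointsMap W L (g.1 (resGal (K := K) L τ)))) ∧
        resBaseChange W L (oneCocycleClass _ g) = oneCocycleClass _ g' := by
  refine ⟨contOneCocycles.pullback (ContinuousMonoidHom.id (Field.absoluteGaloisGroup L))
      (resHomOfEquivariant (ContinuousMonoidHom.id (Field.absoluteGaloisGroup L))
        (localPointsEquivGeomPoints W L : localPoints W L →+ geomPoints (W.baseChange L))
        (localPointsEquivGeomPoints_smul W L))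
      (contOneCocycles.pullback (resGal (K := K) L)
        (resHomOfEquivariant (resGal (K := K) L) (pointsMap W L) (pointsMap_smul W L)) g),
    fun τ => rfl, ?_⟩
  rw [resBaseChange, AddMonoidHom.comp_apply, localRestrictionHom_oneCocycleClass]
  exact map_oneCocycleClass _ _ _ _

end Res

namespace Carrier6137

open MordellDescent ThreeTorsionDescent CPMuDescent MuThreeKernel GaloisRepresentations
open Literature.NumberTheory.NumberFields Literature.NumberTheory.NumberFields.K3

/-! ## The Vélu pair of the carrier over `ℚ` -/

/-- The Vélu three-pair of the carrier: `E = threeTorsionModel (−21/2) (6137/2) → Ê`.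
[cite: CohenPazuki2009, Definition 1.3] -/
theorem isVeluThreePair_E :
    IsVeluThreePair (-21 / 2 : ℚ) (6137 / 2) (threeTorsionModel (-21 / 2 : ℚ) (6137 / 2))
      (threeIsogenyCodomain (-21 / 2 : ℚ) (6137 / 2)) :=
  haveI := isElliptic_W
  isVeluThreePair_threeTorsionModel (threeTorsionModel (-21 / 2 : ℚ) (6137 / 2)).isUnit_Δ.ne_zero

/-- The kernel point `T = (0, 6137/2)` is fixed by `Γ_ℚ`. [cite: CohenPazuki2009, §1.2] -/
theorem smul_geomT (σ : Field.absoluteGaloisGroup ℚ) :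
    σ • (isVeluThreePair_E.geomT : geomPoints (threeTorsionModel (-21 / 2 : ℚ) (6137 / 2))) =
      isVeluThreePair_E.geomT := by
  have hV := isVeluThreePair_E
  change σ • (show geomPoints (threeTorsionModel (-21 / 2 : ℚ) (6137 / 2)) from hV.geom.T) = hV.geom.T
  rw [IsVeluThreePair.T, smul_geomPoints_some σ _ (nonsingular_galAut σ hV.geom.nonsingular_T)]
  exact point_some_ext (map_zero _) (AlgEquiv.commutes _ _)

/-! ## `Ш(E/ℚ) ∩ ker φ_* = 0` -/

/-- Transport of an explicit `Ш`-class along an equality of curves (private helper). [folklore] -/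
private theorem sha_transport {L : Type} [Field L] [NumberField L] {W₁ W₂ : WeierstrassCurve L}
    (h : W₁ = W₂) (k : Field.absoluteGaloisGroup L → ℕ) (y : AlgebraicClosure L)
    (hns₁ : (W₁.baseChange (AlgebraicClosure L)).toAffine.Nonsingular 0 y)
    (hns₂ : (W₂.baseChange (AlgebraicClosure L)).toAffine.Nonsingular 0 y)
    (g₁ : contOneCocycles (discreteTopRep (Field.absoluteGaloisGroup L) (geomPoints W₁)))
    (hg₁ : ∀ τ, g₁.1 τ = k τ • (Affine.Point.some 0 y hns₁ : geomPoints W₁))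
    (g₂ : contOneCocycles (discreteTopRep (Field.absoluteGaloisGroup L) (geomPoints W₂)))
    (hg₂ : ∀ τ, g₂.1 τ = k τ • (Affine.Point.some 0 y hns₂ : geomPoints W₂))
    (hsha : oneCocycleClass _ g₁ ∈ W₁.sha) :
    oneCocycleClass _ g₂ ∈ W₂.sha ∧ (oneCocycleClass _ g₂ = 0 → oneCocycleClass _ g₁ = 0) := by
  subst h
  have : g₁ = g₂ := Subtype.ext (ContinuousMap.ext fun τ => by rw [hg₁, hg₂])
  subst this
  exact ⟨hsha, id⟩

/-- **`Ш(E/ℚ)[φ] = 0` for the carrier `E = threeTorsionModel (−21/2) (6137/2)`**: no non-zero class of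
`Ш(E/ℚ)` is killed by the `3`-isogeny `φ : E → Ê` with rational kernel `⟨(0, 6137/2)⟩`. A class in
`ker φ_*` is `[n·T]` for a cubic character `n` of `Γ_ℚ`; restricted to `K3 = ℚ(ζ₃)` it is the
`μ₃`-torsor class `[C_u]` of `E_{K3}` for `u ∈ K3*` of cube norm (`K3CubicCharacterNorm`), which lies
in `Ш(E/K3)` and therefore vanishes (`Curve6137PhiSideK3`: the Selmer box `⟨[ζ]⟩` is filled by a
rational point); restriction being injective on `Ш[3]` (`3 ∤ [K3 : ℚ]`), the class is zero.
[cite: CohenPazuki2009, Proposition 1.4 (2), Theorem 2.1 and Proposition 2.2]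
[cite: SilvermanAEC2009, Thm. X.4.2 (a)] -/
theorem eq_zero_of_mem_sha_of_galH1Map_geomHom_eq_zero
    {c : (threeTorsionModel (-21 / 2 : ℚ) (6137 / 2)).galH1}
    (hc : c ∈ (threeTorsionModel (-21 / 2 : ℚ) (6137 / 2)).sha)
    (h0 : galH1Map isVeluThreePair_E.geomHom isVeluThreePair_E.geomHom_smul c = 0) : c = 0 := by
  have hV := isVeluThreePair_E
  haveI : (threeTorsionModel (-21 / 2 : ℚ) (6137 / 2)).IsElliptic := isElliptic_W
  -- Step A: `c = [σ ↦ n(σ) T]` for a cubic character `n`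
  have hT0 : hV.geomT ≠ 0 := hV.geomT_ne_zero
  have hTT : hV.geomT + hV.geomT = -hV.geomT := hV.geom.T_add_T
  have hfix : ∀ σ : Field.absoluteGaloisGroup ℚ,
      σ • (hV.geomT : geomPoints (threeTorsionModel (-21 / 2 : ℚ) (6137 / 2))) = hV.geomT := smul_geomT
  have hker : ∀ P : geomPoints (threeTorsionModel (-21 / 2 : ℚ) (6137 / 2)),
      hV.geomHom P = 0 → P = 0 ∨ P = hV.geomT ∨ P = -hV.geomT := by
    intro P hP
    have : P ∈ (hV.geomHom.ker : Set (geomPoints (threeTorsionModel (-21 / 2 : ℚ) (6137 / 2)))) := hP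
    rw [hV.ker_geomHom] at this
    simpa only [Set.mem_insert_iff, Set.mem_singleton_iff] using this
  have hsurj : Function.Surjective hV.geomHom := hV.geom.pointFun_surjective
  obtain ⟨g, n, hg, hn, hlc, hgc⟩ :=
    exists_hom_of_galH1Map_eq_zero hV.geomT hT0 hTT hfix hV.geomHom hV.geomHom_smul hsurj hker c h0
  -- Step B: the restricted character is the Kummer character of `u ∈ K3*` of cube norm
  obtain ⟨u, hu, hκ, hnorm⟩ := exists_kummerExp_eq_resGal_and_norm_eq_cube n hn hlc
  -- Step C: `θ₀ ∈ K3` with `θ₀ ↦ √−3` in `K̄3`; the `μ₃`-kernel datum of `E_{K3} = cpCurve a₃ b₃`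
  obtain ⟨θ₀, hθ, hθalg⟩ : ∃ θ₀ : K3, θ₀ ^ 2 = -3 ∧ algebraMap K3 (AlgebraicClosure K3) θ₀ = theta K3 := by
    rcases theta_K3_eq_or with h | h
    · exact ⟨K3.theta, K3.theta_sq, h.symm⟩
    · exact ⟨-K3.theta, by rw [neg_sq, K3.theta_sq], by rw [map_neg]; exact h.symm⟩
  set 𝒯 := kernelDatum (hb₃ hθ) (hd₃ hθ) with h𝒯
  have hcurves : (threeTorsionModel (-21 / 2 : ℚ) (6137 / 2)).baseChange K3 =
      cpCurve ((7 / 2 : K3) * θ₀) (-(6137 / 6 : K3) * θ₀) := by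
    rw [cpCurve_eq_threeTorsionModel hθ, WeierstrassCurve.baseChange, map_threeTorsionModel]
    congr 1 <;> simp [map_div₀]
  -- the common `y`-coordinate `6137/2` of the kernel points
  set y₀ : AlgebraicClosure K3 := algebraMap K3 (AlgebraicClosure K3) (6137 / 2) with hy₀
  have hyeq : algebraMap K3 (AlgebraicClosure K3) (-(6137 / 6 : K3) * θ₀) * theta K3 = y₀ := by
    rw [← hθalg, ← map_mul, hy₀]; congr 1
    linear_combination (-6137 / 6 : K3) * hθ
  have hns₂ : ((cpCurve ((7 / 2 : K3) * θ₀) (-(6137 / 6 : K3) * θ₀)).baseChange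
      (AlgebraicClosure K3)).toAffine.Nonsingular 0 y₀ := by
    have := (isVeluThreePair_geom (hb₃ hθ) (hd₃ hθ)).nonsingular_T
    rwa [hyeq] at this
  have hns₁ : (((threeTorsionModel (-21 / 2 : ℚ) (6137 / 2)).baseChange K3).baseChange
      (AlgebraicClosure K3)).toAffine.Nonsingular 0 y₀ := by
    rw [hcurves]; exact hns₂
  -- the restricted class `res c = [τ ↦ n(τ|_ℚ̄) · (0, y₀)]`
  obtain ⟨g₁, hg₁, hres⟩ := resBaseChange_oneCocycleClass (threeTorsionModel (-21 / 2 : ℚ) (6137 / 2)) K3 g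
  have hy : iotaE (K := ℚ) K3 (algebraMap ℚ (AlgebraicClosure ℚ) (6137 / 2)) = y₀ := by
    have e0 : iotaE (K := ℚ) K3 (algebraMap ℚ (AlgebraicClosure ℚ) (6137 / 2)) =
        algebraMap ℚ (AlgebraicClosure K3) (6137 / 2) := (iotaE (K := ℚ) K3).commutes _
    rw [e0, IsScalarTower.algebraMap_apply ℚ K3 (AlgebraicClosure K3), hy₀, map_div₀, map_ofNat, map_ofNat]
  have hns' : ((threeTorsionModel (-21 / 2 : ℚ) (6137 / 2)).baseChange (AlgebraicClosure K3)).toAffine.Nonsingular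
      (iotaE (K := ℚ) K3 0) (iotaE (K := ℚ) K3 (algebraMap ℚ (AlgebraicClosure ℚ) (6137 / 2))) := by
    rw [map_zero, hy, ← baseChange_baseChange (threeTorsionModel (-21 / 2 : ℚ) (6137 / 2)) K3
      (AlgebraicClosure K3)]
    exact hns₁
  have hT_L : localPointsEquivGeomPoints (threeTorsionModel (-21 / 2 : ℚ) (6137 / 2)) K3
      (pointsMap (threeTorsionModel (-21 / 2 : ℚ) (6137 / 2)) K3 hV.geomT) = Affine.Point.some 0 y₀ hns₁ := by
    have e1 : pointsMap (threeTorsionModel (-21 / 2 : ℚ) (6137 / 2)) K3 hV.geomT =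
        (show localPoints (threeTorsionModel (-21 / 2 : ℚ) (6137 / 2)) K3 from Affine.Point.some _ _ hns') :=
      pointsMap_some hV.geom.nonsingular_T hns'
    rw [e1]
    change Affine.Point.congrEquiv (baseChange_baseChange (threeTorsionModel (-21 / 2 : ℚ) (6137 / 2)) K3
      (AlgebraicClosure K3)).symm (Affine.Point.some _ _ hns') = _
    rw [Affine.Point.congrEquiv_some]
    exact point_some_ext (map_zero _) hy
  have hg₁' : ∀ τ, g₁.1 τ = (n (resGal (K := ℚ) K3 τ)).val •
      (Affine.Point.some 0 y₀ hns₁ : geomPoints ((threeTorsionModel (-21 / 2 : ℚ) (6137 / 2)).baseChange K3)) := by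
    intro τ; rw [hg₁, hg, map_nsmul, map_nsmul, hT_L]; rfl
  -- the torsor cocycle of `u` on `cpCurve a₃ b₃` has the same values
  have hT₃ : 𝒯.T = Affine.Point.some 0 y₀ hns₂ := by
    rw [h𝒯, kernelDatum_T, CPMuDescent.torsT_eq]
    exact point_some_ext rfl hyeq
  have hg₂ : ∀ τ, (𝒯.torsorCocycle hu).1 τ = (n (resGal (K := ℚ) K3 τ)).val •
      (Affine.Point.some 0 y₀ hns₂ : geomPoints (cpCurve ((7 / 2 : K3) * θ₀) (-(6137 / 6 : K3) * θ₀))) := by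
    intro τ
    rw [MuThreeKernel.torsorCocycle_apply, MuThreeKernel.torsorFun, MuThreeKernel.chiT_eq_val_nsmul, hκ, hT₃]
    rfl
  -- `res c ∈ Ш(E_{K3}/K3)`, transported to `cpCurve a₃ b₃`, is `[C_u]`, which vanishes
  have hres_sha : oneCocycleClass _ g₁ ∈ ((threeTorsionModel (-21 / 2 : ℚ) (6137 / 2)).baseChange K3).sha := by
    rw [← hres]; exact resBaseChange_mem_sha _ K3 (hgc ▸ hc)
  obtain ⟨hsha₃, hback⟩ := sha_transport hcurves (fun τ => (n (resGal (K := ℚ) K3 τ)).val) y₀ hns₁ hns₂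
    g₁ hg₁' (𝒯.torsorCocycle hu) hg₂ hres_sha
  have hzero₃ : oneCocycleClass _ (𝒯.torsorCocycle hu) = 0 :=
    torsorClass_eq_zero_of_mem_sha_of_norm_cube hθ hu hsha₃ hnorm
  have hres0 : resBaseChange (threeTorsionModel (-21 / 2 : ℚ) (6137 / 2)) K3 c = 0 := by
    rw [← hgc, hres]; exact hback hzero₃
  -- restriction is injective on `Ш[3]`
  haveI : IsGalois ℚ K3 := IsCyclotomicExtension.isGalois {3} ℚ K3
  set c' : (threeTorsionModel (-21 / 2 : ℚ) (6137 / 2)).sha := ⟨c, hc⟩ with hc'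
  have h3T : (3 : ℕ) • hV.geomT = 0 := by rw [succ_nsmul, two_nsmul, hTT, neg_add_cancel]
  have h3 : 3 • c' = 0 := by
    apply Subtype.ext
    change 3 • c = 0
    rw [← hgc]
    refine nsmul_oneCocycleClass_eq_zero _ 3 fun σ => ?_
    rw [hg, ← mul_nsmul, mul_comm, mul_nsmul, h3T, nsmul_zero]
  have hres' : shaRestriction (threeTorsionModel (-21 / 2 : ℚ) (6137 / 2)) K3 c' = 0 :=
    Subtype.ext (by rw [coe_shaRestriction_apply]; exact hres0)
  have hcop : Nat.Coprime 3 (Module.finrank ℚ K3) := by rw [finrank_eq]; decide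
  have := (shaRestriction_eq_zero_iff_of_coprime (threeTorsionModel (-21 / 2 : ℚ) (6137 / 2)) K3 hcop c' h3).mp hres'
  exact congrArg Subtype.val this

end Carrier6137

end Literature.NumberTheory.EllipticCurves

end
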